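import Literature.MathematicalPhysics.QuantumFieldTheory.Balaban1983to89.B11Eq44Concrete
import Literature.MathematicalPhysics.QuantumFieldTheory.Balaban1983to89.B12SecondOrder267

/-!
# `Balaban1983to89.B12SecondOrder267Concrete` — T. Bałaban, *Renormalization group approach to lattice gauge field theories. I*, Commun.
Math. Phys. **109** (1987) 249–301 [Balaban1987RG1], p. 267: **«there exists exactly one solution of this equation, and … it is an analytic
function of B. … D̃(B) has an expansion beginning with quadratic terms, and D̃⁽²⁾(B) = C̃⁽²⁾(B)» FOR THE CONCRETE REMAINDER `C̃ = C_j(U₀, ·)` OF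
[B7] ON THE `ℤᵈ` CARRIER** — the two standing HYPOTHESES of the tree's p. 267 files (`B13Contraction113.QuadAnalytic Ct C₂ R` and
`AnalyticOnNhd ℂ Ct {‖Y‖ < R}` over abstract complex Banach spaces) DISCHARGED for `Ct := B11Eq44Concrete.Cmap`, and their typing of
«C̃⁽²⁾(B)» as `½·D²C̃(0)(B, B)` IDENTIFIED with [B7]'s concrete second-order term `C_j⁽²⁾(U₀, ins_S B)` (`B7Eq136SecondOrder.CCovIter2`)

statement-level skeleton of published theorems with citation tags; proofs where landed; nothing here is a claim about the Yang–Mills mass gap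

PDF held: `paper:balaban1987-cmp109-rg-i-small-field` (PDF page = journal page − 248); p. 267 [PDF 19] read from the text layer `p0019.txt`;
[B11] = `paper:balaban1985-cmp102-variational-background` p. 286 [PDF 10]; [B7] = `paper:balaban1985-cmp98-averaging` pp. 38–39.

CITATION HEADER / WHAT IS REPRODUCED.  Cell `lit-balaban`, Phase-2 proof seat p06 gen 5 = unit `lit-balaban-p06` (TAKING line HOME/STATUS.md
2026-08-21T08:23:03Z; file 5 of the `C_j⁽²⁾` lane, on top of `B11Eq44Concrete`); SKELETON rows **B12.Def@267** (owner r09: «∃! analytic D̃ with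
LQ̃B − D̃(B) + C̃(B − hD̃(B)) = LQ̃B; D̃ starts at order 2, D̃^{(2)} = C̃^{(2)}» — `B12Lineariz267`, `B12LinearizAnalytic267`, `B12SecondOrder267`,
all over ABSTRACT spaces with `QuadAnalytic Ct` and `AnalyticOnNhd ℂ Ct` as hypotheses) and **B11.Eq51** (owner r08: «it is an analytic function
of A′», joint form).  THE PRINT, [B12] p. 267 [PDF 19]: *«Here we have a particularly simple unit lattice situation. … We are looking for an
analytic, 𝐠-valued function D̃(B′), defined at bonds of T⁽ᵏ⁺¹⁾, and such that the transformation B′ = B − hD̃(B) linearizes the function Q̃(B′).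
The function D̃(B) is determined by the equation LQ̃B′ + C̃(B′) = LQ̃B − D̃(B) + C̃(B − hD̃(B)) = LQ̃B. It is easy to prove, following the proofs in
the above mentioned papers, that there exists exactly one solution of this equation, and that it is an analytic function of B. From this
equation we obtain also that D̃(B) has an expansion beginning with quadratic terms, and D̃⁽²⁾(B) = C̃⁽²⁾(B).»*  [B11] p. 286 [PDF 10]: *«This
solution … is an analytic function of A′.»*  [B7] p. 39: *«C_k(U₀, A) = C_k^{(2)}(U₀, A) + C_k^{(3)}(U₀, A) + … . (136)»*.

DICTIONARY (as in `B11Eq44Concrete` and `B12SecondOrder267`).  `𝒴 := 𝔸^S`, `𝒳 := 𝔸^T` (sup norms); print's `C̃` ↦ `Cmap L U₀ S T j`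
(`= (C_j(U₀, ins_S a)(c))_{c∈T}`, [B7]'s remainder at a regular background `U₀`, any level `j ≤ k`; print's «unit lattice situation» is one
averaging step — this file does not identify print's carriers `T⁽ᵏ⁾ → T⁽ᵏ⁺¹⁾` with `S`, `T`); print's `h` ↦ an ABSTRACT linear `hop : 𝔸^T →ₗ[ℂ] 𝔸^S`
with `‖hX‖ ≤ B₀‖X‖` (the tree's `B12HOperator267` computes the printed one; not used here); print's `D̃` ↦ ANY `Dt : 𝔸^S → 𝔸^T` with the
fixed-point characterization `Cmap (B − hop (Dt B)) = Dt B`, `‖Dt B‖ ≤ 4C₂(Lʲ)²ε²` on `‖B‖ < ε` (`B12Lineariz267.exists_Dt`, here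
`exists_Dt_concrete`); r09's typing of «C̃⁽²⁾(B)» is `(2:ℂ)⁻¹ • iteratedFDeriv ℂ 2 Ct 0 (fun _ => B)`.

WHAT THIS FILE PROVES (theorems only; kernel, 0 sorry, standard axioms).
* §1 **JOINT ANALYTICITY OF THE CONCRETE `C̃`**: `analyticAt_Cmap` (at every `a` of the closed polydisc `‖a_s‖ ≤ b`, from
  `B7Eq136SecondOrder.analyticAt_CCovIter_ins` by `AnalyticAt.pi`), **`analyticOnNhd_Cmap : AnalyticOnNhd ℂ Cmap {‖a‖ < b}`** — the second
  hypothesis of the p. 267 files, next to `B11Eq44Concrete.quadAnalytic_Cmap`.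
* §2 **«C̃⁽²⁾(B)» IS [B7]'s `C_j⁽²⁾`**: `iteratedFDeriv_two_Cmap_apply` (components of `D²Cmap(0)`), **`half_iteratedFDeriv_two_Cmap`**
  (`(2:ℂ)⁻¹ • iteratedFDeriv ℂ 2 Cmap 0 (fun _ => B) = C2map B B`) and `half_iteratedFDeriv_two_Cmap_eq_CCovIter2` (`= (C_j⁽²⁾(U₀, ins_S B)(c))_c`).
* §3 **p. 267 FOR THE CONCRETE `C̃`**, by name: `exists_Dt_concrete` («exactly one solution» — existence of `D̃` on `‖B‖ < ε`; uniqueness is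
  `B11Eq44Concrete.exists_unique_fixedPoint_concrete`), **`analyticOnNhd_Dt_concrete`** («an analytic function of B» JOINTLY on the ball —
  `B12LinearizAnalytic267.analyticOnNhd_Dt`; upgrades the line-wise `B11Eq44Concrete.analytic_fixedPoint_concrete`), **`p267_second_order_concrete`**
  («beginning with quadratic terms, and D̃⁽²⁾(B) = C̃⁽²⁾(B)» — `B12SecondOrder267.p267_second_order` with the second-order term rewritten as
  [B7]'s `C_j⁽²⁾`: `D̃(0) = 0`, `DD̃(0) = 0`, `D²D̃(0) = D²C̃(0)`, `D̃₃(B) = D̃(B) − C_j⁽²⁾(U₀, ins_S B)` analytic on the ball and `O(‖B‖³)`,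
  `g⁻²D̃(gB′) → C_j⁽²⁾(U₀, ins_S B′)` as `g → 0`).
NOT CLAIMED: print's operator `h` (abstract here), the identification of carriers with `T⁽ᵏ⁾ → T⁽ᵏ⁺¹⁾`, the scaling `B = g_kB′` inside (2.10)–(2.11).
-/

noncomputable section

open scoped BigOperators Topology
open NormedSpace Finset Metric Filter

namespace Literature.MathematicalPhysics.QuantumFieldTheory.Balaban1983to89.B12SecondOrder267Concrete

open B7Prop1Explicit B7Prop1Local B7Prop2Explicit B7Prop3Flat B7Prop4Flat B7Eq92Concrete B7Prop3GeneralLinear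
  B7Prop4GeneralLevels B7Prop5GeneralOperators B7Prop5GeneralInduction B7Prop5GeneralLevels B7Ineq149Pairing B7Eq136SecondOrder
  B7Eq136Expansion B13Contraction113 B11Eq44Concrete B12Lineariz267 B12LinearizAnalytic267 B12SecondOrder267

-- `Site` alone would resolve to the torus sites of `Setup.lean`; re-export the `ℤ^d` sites of `B7Prop1Explicit`.
export B7Prop1Explicit (Site)

variable {d : ℕ}

section Regime

variable {𝔸 : Type*} [NormedRing 𝔸] [NormedAlgebra ℂ 𝔸] [CompleteSpace 𝔸] [NormOneClass 𝔸]

variable (L : ℕ) (hL : 2 ≤ L) {G : Subgroup 𝔸ˣ} (hG : AvgClosed d L G) (k : ℕ)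
  (U₀ : Site d → Fin d → 𝔸ˣ) (hU₀ : ∀ x κ, U₀ x κ ∈ G) {α₀ : ℝ} (hα : 0 < α₀)
  (hα3 : C0 d * α₀ ≤ 1 / 3) (hα4 : 4 * α₀ ≤ c2' d L) (h52 : pdev U₀ < α₀ * (((L : ℝ) ^ k)⁻¹) ^ 2)
  {b : ℝ} (hb : 0 < b)
  (hsmall : Real.exp (4 * (800 * ((d : ℝ) + 1) ^ 2 * ((d : ℝ) + 4)) * α₀)
    * (1 + 8 * (131072 * ((d : ℝ) + 1) ^ 2) * ((L : ℝ) ^ k * b)) ≤ 2)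
  (hc₃ : 4 * ((L : ℝ) ^ k * b) < c3 d L)
  (S T : Finset (Site d × Fin d))

/-- print's `C₂` of [B11] (44) = [B7] (135) at a general background (`B7Eq123General.prop4_general` (i)). -/
local notation "C₂" => (8 * (131072 * ((d : ℝ) + 1) ^ 2) * Real.exp (4 * (800 * ((d : ℝ) + 1) ^ 2 * ((d : ℝ) + 4)) * α₀))

/-! ## §1 Joint analyticity of the concrete `C̃ = Cmap` -/

include hL hG hU₀ hα hα3 hα4 h52 hb hsmall hc₃ in
/-- **`Cmap` is (jointly) analytic at every point of the closed polydisc `‖a_s‖ ≤ b`** — each component `a ↦ C_j(U₀, ins_S a)(c)` is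
([B7] Prop. 4 at a general background, `B7Eq136SecondOrder.analyticAt_CCovIter_ins`), and a finite family of analytic components is analytic
into the product (`AnalyticAt.pi`). [cite: Balaban1987RG1, p.267] [cite: Balaban1985Averaging, Prop. 4 p.38] -/
theorem analyticAt_Cmap {j : ℕ} (hj : j ≤ k) {a : S → 𝔸} (ha : ∀ s, ‖a s‖ ≤ b) :
    AnalyticAt ℂ (Cmap L U₀ S T j) a :=
  AnalyticAt.pi fun c : T => analyticAt_CCovIter_ins L hL hG k U₀ hU₀ hα hα3 hα4 h52 hb hsmall hc₃ S hj c.1.1 c.1.2 ha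

include hL hG hU₀ hα hα3 hα4 h52 hb hsmall hc₃ in
/-- **THE SECOND HYPOTHESIS OF THE p. 267 FILES, CONCRETE**: `AnalyticOnNhd ℂ Cmap {a | ‖a‖ < b}` («an analytic … function», the `hCa` input
of `B12LinearizAnalytic267`/`B12SecondOrder267`). [cite: Balaban1987RG1, p.267] [cite: Balaban1985Averaging, Prop. 4 p.38] -/
theorem analyticOnNhd_Cmap {j : ℕ} (hj : j ≤ k) : AnalyticOnNhd ℂ (Cmap L U₀ S T j) {a : S → 𝔸 | ‖a‖ < b} :=
  fun a ha => analyticAt_Cmap L hL hG k U₀ hU₀ hα hα3 hα4 h52 hb hsmall hc₃ S T hj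
    fun s => (norm_le_pi_norm a s).trans (le_of_lt ha)

/-! ## §2 «C̃⁽²⁾(B)» is [B7]'s concrete second-order term -/

include hL hG hU₀ hα hα3 hα4 h52 hb hsmall hc₃ in
/-- the components of the second Fréchet derivative of `Cmap` at `0` are the second derivatives of its components (evaluation at a coarse
bond is a continuous linear map; `ContinuousLinearMap.iteratedFDeriv_comp_left`). [cite: Balaban1987RG1, p.267]
[cite: Balaban1985Averaging, (136) p.39] -/
theorem iteratedFDeriv_two_Cmap_apply {j : ℕ} (hj : j ≤ k) (m : Fin 2 → (S → 𝔸)) (c : T) :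
    iteratedFDeriv ℂ 2 (Cmap L U₀ S T j) 0 m c =
      iteratedFDeriv ℂ 2 (fun a' : S → 𝔸 => CCovIter L U₀ (insCfg S a') j c.1.1 c.1.2) 0 m := by
  have han : AnalyticAt ℂ (Cmap L U₀ S T j) 0 :=
    analyticAt_Cmap L hL hG k U₀ hU₀ hα hα3 hα4 h52 hb hsmall hc₃ S T hj (fun s => by simpa using hb.le)
  have hcomp : (fun a' : S → 𝔸 => CCovIter L U₀ (insCfg S a') j c.1.1 c.1.2) =
      (ContinuousLinearMap.proj (R := ℂ) c) ∘ (Cmap L U₀ S T j) := rfl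
  rw [hcomp, (ContinuousLinearMap.proj (R := ℂ) c).iteratedFDeriv_comp_left (han.contDiffAt (n := 2)) le_rfl,
    ContinuousLinearMap.compContinuousMultilinearMap_coe, Function.comp_apply, ContinuousLinearMap.proj_apply]

include hL hG hU₀ hα hα3 hα4 h52 hb hsmall hc₃ in
/-- **r09's «C̃⁽²⁾(B)» = the diagonal of the polarization**: `(2:ℂ)⁻¹ • iteratedFDeriv ℂ 2 Cmap 0 (fun _ => B) = C2map B B`.
[cite: Balaban1987RG1, p.267] [cite: Balaban1985Variational, (56) p.286] -/
theorem half_iteratedFDeriv_two_Cmap {j : ℕ} (hj : j ≤ k) (B : S → 𝔸) :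
    (2 : ℂ)⁻¹ • iteratedFDeriv ℂ 2 (Cmap L U₀ S T j) 0 (fun _ => B) = C2map L U₀ S T j B B := by
  funext c
  rw [Pi.smul_apply, iteratedFDeriv_two_Cmap_apply L hL hG k U₀ hU₀ hα hα3 hα4 h52 hb hsmall hc₃ S T hj, iteratedFDeriv_two_apply,
    C2map_apply]

include hL hG hU₀ hα hα3 hα4 h52 hb hsmall hc₃ in
/-- **«C̃⁽²⁾(B)» IS [B7]'s `C_j⁽²⁾(U₀, ins_S B)`**: `(2:ℂ)⁻¹ • iteratedFDeriv ℂ 2 Cmap 0 (fun _ => B) = (CCovIter2 L U₀ (ins_S B) j c)_{c∈T}` — the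
abstract second-order term of the p. 267 files, for the concrete `C̃`, is the second-order term of [B7] (136) (`B11Eq44Concrete.C2map_self`).
[cite: Balaban1987RG1, p.267] [cite: Balaban1985Averaging, (136) p.39] -/
theorem half_iteratedFDeriv_two_Cmap_eq_CCovIter2 {j : ℕ} (hj : j ≤ k) (B : S → 𝔸) :
    (2 : ℂ)⁻¹ • iteratedFDeriv ℂ 2 (Cmap L U₀ S T j) 0 (fun _ => B) =
      fun c : T => CCovIter2 L U₀ (insCfg S B) j c.1.1 c.1.2 := by
  rw [half_iteratedFDeriv_two_Cmap L hL hG k U₀ hU₀ hα hα3 hα4 h52 hb hsmall hc₃ S T hj,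
    C2map_self L hL hG k U₀ hU₀ hα hα3 hα4 h52 hb hsmall hc₃ S T hj]

/-! ## §3 p. 267 for the concrete `C̃`: existence, joint analyticity, «D̃⁽²⁾ = C̃⁽²⁾» -/

variable (hop : (T → 𝔸) →ₗ[ℂ] (S → 𝔸)) {B₀ ε : ℝ}

include hL hG hU₀ hα hα3 hα4 h52 hb hsmall hc₃ in
/-- **«there exists exactly one solution of this equation» — existence, CONCRETE**: a function `D̃` on `𝔸^S` with
`C̃(B − hD̃(B)) = D̃(B)` and `‖D̃(B)‖ ≤ 4C₂(Lʲ)²ε²` for `‖B‖ < ε` (`B12Lineariz267.exists_Dt` fed with `quadAnalytic_Cmap`; uniqueness in the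
ball is `B11Eq44Concrete.exists_unique_fixedPoint_concrete`). [cite: Balaban1987RG1, p.267] [cite: Balaban1985Variational, (49)-(54) pp.285-286] -/
theorem exists_Dt_concrete {j : ℕ} (hj : j ≤ k) (hB₀ : 0 ≤ B₀) (hHop : ∀ X, ‖hop X‖ ≤ B₀ * ‖X‖)
    (hq : 9 * (C₂ * ((L : ℝ) ^ j) ^ 2) * B₀ * ε < 1) (hε : 3 * ε ≤ b) :
    ∃ Dt : (S → 𝔸) → (T → 𝔸), ∀ B : S → 𝔸, ‖B‖ < ε →
      Dt B ∈ closedBall (0 : T → 𝔸) (4 * (C₂ * ((L : ℝ) ^ j) ^ 2) * ε ^ 2) ∧ Cmap L U₀ S T j (B - hop (Dt B)) = Dt B :=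
  exists_Dt (quadAnalytic_Cmap L hL hG k U₀ hU₀ hα hα3 hα4 h52 hb hsmall hc₃ S T hj) (by positivity) hB₀ hHop hq hε

include hL hG hU₀ hα hα3 hα4 h52 hb hsmall hc₃ in
/-- **«it is an analytic function of B», JOINTLY, CONCRETE**: any `D̃` with the fixed-point characterization on `‖B‖ < ε` is analytic on a
neighbourhood of every point of that ball (`B12LinearizAnalytic267.analyticOnNhd_Dt` fed with `quadAnalytic_Cmap` and `analyticOnNhd_Cmap`) —
[B11] p. 286 «an analytic function of A′» in the Fréchet sense, upgrading the line-wise `B11Eq44Concrete.analytic_fixedPoint_concrete`.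
[cite: Balaban1987RG1, p.267] [cite: Balaban1985Variational, (54) p.286] -/
theorem analyticOnNhd_Dt_concrete {j : ℕ} (hj : j ≤ k) (hB₀ : 0 ≤ B₀) (hHop : ∀ X, ‖hop X‖ ≤ B₀ * ‖X‖)
    (hq : 9 * (C₂ * ((L : ℝ) ^ j) ^ 2) * B₀ * ε < 1) (hε : 3 * ε ≤ b) {Dt : (S → 𝔸) → (T → 𝔸)}
    (hDball : ∀ B : S → 𝔸, ‖B‖ < ε → Dt B ∈ closedBall (0 : T → 𝔸) (4 * (C₂ * ((L : ℝ) ^ j) ^ 2) * ε ^ 2))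
    (hDfix : ∀ B : S → 𝔸, ‖B‖ < ε → Cmap L U₀ S T j (B - hop (Dt B)) = Dt B) :
    AnalyticOnNhd ℂ Dt (ball (0 : S → 𝔸) ε) :=
  analyticOnNhd_Dt (quadAnalytic_Cmap L hL hG k U₀ hU₀ hα hα3 hα4 h52 hb hsmall hc₃ S T hj)
    (analyticOnNhd_Cmap L hL hG k U₀ hU₀ hα hα3 hα4 h52 hb hsmall hc₃ S T hj) (by positivity) hB₀ hHop hq hε hDball hDfix

include hL hG hU₀ hα hα3 hα4 h52 hb hsmall hc₃ in
/-- **«D̃(B) has an expansion beginning with quadratic terms, and D̃⁽²⁾(B) = C̃⁽²⁾(B)», CONCRETE** — `B12SecondOrder267.p267_second_order` for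
`C̃ = Cmap`, with r09's «C̃⁽²⁾(B)» rewritten as [B7]'s `C_j⁽²⁾(U₀, ins_S B)` (§2): for any `D̃` with the fixed-point characterization on `‖B‖ < ε`,
(i) `D̃(0) = 0`, `DD̃(0) = 0`; (ii) `D̃` has a power series at `0` whose terms of order `0`, `1` vanish; (iii) `D²D̃(0) = D²C̃(0)`, so the second-order
term of `D̃` is `(C_j⁽²⁾(U₀, ins_S B)(c))_c`; (iv) the remainder `D̃₃(B) = D̃(B) − (C_j⁽²⁾(U₀, ins_S B)(c))_c` is analytic on the ball and `O(‖B‖³)`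
at `0`; (v) the scaling limit `g⁻²D̃(gB′) → (C_j⁽²⁾(U₀, ins_S B′)(c))_c` as `g → 0`. [cite: Balaban1987RG1, p.267]
[cite: Balaban1985Averaging, (136) p.39] [cite: Balaban1985Variational, (56) p.286] -/
theorem p267_second_order_concrete {j : ℕ} (hj : j ≤ k) (hB₀ : 0 ≤ B₀) (hHop : ∀ X, ‖hop X‖ ≤ B₀ * ‖X‖)
    (hq : 9 * (C₂ * ((L : ℝ) ^ j) ^ 2) * B₀ * ε < 1) (hε : 3 * ε ≤ b) (hε0 : 0 < ε) {Dt : (S → 𝔸) → (T → 𝔸)}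
    (hDball : ∀ B : S → 𝔸, ‖B‖ < ε → Dt B ∈ closedBall (0 : T → 𝔸) (4 * (C₂ * ((L : ℝ) ^ j) ^ 2) * ε ^ 2))
    (hDfix : ∀ B : S → 𝔸, ‖B‖ < ε → Cmap L U₀ S T j (B - hop (Dt B)) = Dt B) :
    (Dt 0 = 0 ∧ fderiv ℂ Dt 0 = 0) ∧
    ((∃ p : FormalMultilinearSeries ℂ (S → 𝔸) (T → 𝔸), HasFPowerSeriesAt Dt p 0) ∧
      ∀ p : FormalMultilinearSeries ℂ (S → 𝔸) (T → 𝔸), HasFPowerSeriesAt Dt p 0 → p 0 = 0 ∧ p 1 = 0) ∧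
    (iteratedFDeriv ℂ 2 Dt (0 : S → 𝔸) = iteratedFDeriv ℂ 2 (Cmap L U₀ S T j) 0 ∧
      ∀ B : S → 𝔸, (2 : ℂ)⁻¹ • iteratedFDeriv ℂ 2 Dt (0 : S → 𝔸) (fun _ => B) =
        fun c : T => CCovIter2 L U₀ (insCfg S B) j c.1.1 c.1.2) ∧
    (AnalyticOnNhd ℂ (fun B => Dt B - fun c : T => CCovIter2 L U₀ (insCfg S B) j c.1.1 c.1.2) (ball (0 : S → 𝔸) ε) ∧
      (fun B => Dt B - fun c : T => CCovIter2 L U₀ (insCfg S B) j c.1.1 c.1.2) =O[𝓝 (0 : S → 𝔸)] fun B => ‖B‖ ^ 3) ∧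
    (∀ B' : S → 𝔸, Tendsto (fun g : ℂ => (g ^ 2)⁻¹ • Dt (g • B')) (𝓝[≠] 0)
      (𝓝 (fun c : T => CCovIter2 L U₀ (insCfg S B') j c.1.1 c.1.2))) := by
  have hC := quadAnalytic_Cmap L hL hG k U₀ hU₀ hα hα3 hα4 h52 hb hsmall hc₃ S T hj
  have hCa := analyticOnNhd_Cmap L hL hG k U₀ hU₀ hα hα3 hα4 h52 hb hsmall hc₃ S T hj
  obtain ⟨h01, hps, ⟨h2, -⟩, -, ⟨h3an, h3O⟩, hsc⟩ :=
    p267_second_order hC hCa (by positivity) hB₀ hHop hq hε hDball hDfix hε0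
  -- rewrite r09's second-order term of `C̃` as [B7]'s `C_j⁽²⁾`
  have hid : ∀ B : S → 𝔸, (2 : ℂ)⁻¹ • iteratedFDeriv ℂ 2 (Cmap L U₀ S T j) 0 (fun _ => B) =
      fun c : T => CCovIter2 L U₀ (insCfg S B) j c.1.1 c.1.2 :=
    fun B => half_iteratedFDeriv_two_Cmap_eq_CCovIter2 L hL hG k U₀ hU₀ hα hα3 hα4 h52 hb hsmall hc₃ S T hj B
  have hfun : (fun B => Dt B - fun c : T => CCovIter2 L U₀ (insCfg S B) j c.1.1 c.1.2) =
      fun B => Dt B - (2 : ℂ)⁻¹ • iteratedFDeriv ℂ 2 (Cmap L U₀ S T j) 0 (fun _ => B) := by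
    funext B
    rw [hid B]
  refine ⟨h01, hps, ⟨h2, fun B => ?_⟩, ⟨?_, ?_⟩, fun B' => ?_⟩
  · rw [h2]
    exact hid B
  · rw [hfun]
    exact h3an
  · rw [hfun]
    exact h3O
  · rw [← hid B']
    exact hsc B'

end Regime

end Literature.MathematicalPhysics.QuantumFieldTheory.Balaban1983to89.B12SecondOrder267Concrete

end
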